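import Mathlib
import Summits.Ventures.PercRepro2.TB14NoDep

/-!
# Row 2′TB: the NoDep slice (II) — the star flip of `o`'s component is an INVOLUTION
(blind cell PercRepro2, mine-c g23, 2026-08-26; `conjectures/MINE-C.md` §32.4; part I =
`TB14NoDep.lean`: `Arms`, `oArm`, `NoDep`, `admissible_oArm`, `isTgt_starFlip_oArm`)

For a source `y` with NO DEPENDENT CORE VERTEX (`NoDep`: every vertex of `T_r ∩ T_b` stays
red-connected to `a₂` with the edges at `Z := oArm y` closed):
* `conn_starFlip_iff`: the red cluster of `a₂` after the flip is `T_r ∖ Z`;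
* `conn_blue_starFlip_iff`: the blue cluster after the flip is `T_b ∪ Z` (no hypothesis);
* `core_starFlip_iff`, `arms_starFlip_iff`, `oArm_starFlip`, `noDep_starFlip`: the core, the arms,
  `Z` and `NoDep` are preserved — so (`starFlip_starFlip`) the flip is an involution of the slice;
* `card_ndSrc_le_card_ndTgt`: the NoDep sources inject into the NoDep targets at the all-free
  profile of every finite multigraph (`ndSrc`, `ndTgt`; the mark `b` carried by `isTgt_starFlip`).
The trivial core (`TB14TrivialCore`) is the case `T_r ∩ T_b = {a₂}`.  Own work; standard axioms.
-/

namespace Summit.Ventures.PercRepro2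

namespace TB14NoDepInv

open CovForm A3InactiveTyped TB14FlipFamily TB14Hall TB14NoDep

section Flip

variable {V : Type} {E : Type} [DecidableEq E] [Fintype V]
variable (ends : E → Sym2 V) (a₁ a₂ b o : V) (F : Finset E)

omit [DecidableEq E] [Fintype V] in
/-- The star flip is an involution. -/
lemma starFlip_starFlip (Z : Finset V) (y : Config E) :
    starFlip ends Z (starFlip ends Z y) = y := by
  funext e
  by_cases h : Touch ends Z e
  · rw [starFlip_of_touch ends h, starFlip_of_touch ends h, Bool.not_not]
  · rw [starFlip_of_not_touch ends h, starFlip_of_not_touch ends h]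

omit [DecidableEq E] [Fintype V] in
/-- Closing the edges at `Z` is blind to the star flip of `Z`. -/
lemma offZ_starFlip (Z : Finset V) (y : Config E) :
    offZ ends Z (starFlip ends Z y) = offZ ends Z y := by
  funext e
  unfold offZ
  by_cases h : Touch ends Z e
  · rw [if_pos h, if_pos h]
  · rw [if_neg h, if_neg h, starFlip_of_not_touch ends h]

omit [DecidableEq E] [Fintype V] in
/-- `offZ Z y ≤ starFlip Z y`. -/
lemma offZ_le_starFlip (Z : Finset V) (y : Config E) : offZ ends Z y ≤ starFlip ends Z y := by
  intro e
  unfold offZ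
  by_cases h : Touch ends Z e
  · rw [if_pos h]; exact Bool.false_le _
  · rw [if_neg h, starFlip_of_not_touch ends h]

/-- **(R)** Under `NoDep`, after the flip the red cluster of `a₂` is `T_r ∖ Z`. -/
lemma conn_starFlip_iff (hF : ∀ e, e ∈ F) {y : Config E} (hs : IsSrc ends a₁ a₂ b o F y)
    (hnd : NoDep ends a₂ o F y) (v : V) :
    Conn ends (starFlip ends (oArm ends a₂ o F y) y) a₂ v ↔
      Conn ends y a₂ v ∧ v ∉ oArm ends a₂ o F y := by
  set Z := oArm ends a₂ o F y with hZdef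
  have ho : Arms ends a₂ F y o := arms_o_of_isSrc ends a₁ a₂ b o F hs
  have hZ : Admissible ends a₁ a₂ o F Z y := admissible_oArm ends a₁ a₂ b o F hF hs
  have ha₂ : a₂ ∉ Z := a2_not_mem_oArm ends a₂ o F ho
  constructor
  · intro hv
    have h' := conn_offZ_of_conn_starFlip ends a₁ a₂ o F hF hZ hv
    exact ⟨conn_mono (offZ_le ends y) h', not_mem_of_conn_offZ ends ha₂ h'⟩
  · rintro ⟨hv, hvZ⟩
    have key : v ∈ {x : V | x ∈ Z ∨ Conn ends (starFlip ends Z y) a₂ x} := by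
      refine mem_of_conn_of_closed (ends := ends) (ω := y) ?_ (Or.inr (conn_refl _ _ _)) hv
      intro x hx z hxz
      obtain ⟨_, e, he, hends⟩ := openGraph_adj.1 hxz
      simp only [Set.mem_setOf_eq] at hx ⊢
      by_cases hxZ : x ∈ Z
      · by_cases hzZ : z ∈ Z
        · exact Or.inl hzZ
        · -- `z` is a core vertex: `NoDep` keeps it red-connected off `Z`
          obtain ⟨hzr, hzb⟩ := blue_of_red_adj_oArm ends a₁ a₂ b o F hF hs hxZ hzZ he hends
          exact Or.inr (conn_mono (offZ_le_starFlip ends Z y) (hnd z hzr hzb))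
      · rcases hx with hx | hx
        · exact absurd hx hxZ
        · by_cases hzZ : z ∈ Z
          · exact Or.inl hzZ
          · have hT : ¬ Touch ends Z e := fun hT =>
              (mem_or_mem_of_touch ends hends hT).elim hxZ hzZ
            have he' : starFlip ends Z y e = true := by
              rw [starFlip_of_not_touch ends hT]; exact he
            exact Or.inr (conn_trans hx (conn_of_openAdj ⟨e, he', hends⟩))
    simp only [Set.mem_setOf_eq] at key
    exact key.resolve_left hvZ

/-- **(B)** After the flip the blue cluster of `a₂` is `T_b ∪ Z` (every source). -/
lemma conn_blue_starFlip_iff (hF : ∀ e, e ∈ F) {y : Config E} (hs : IsSrc ends a₁ a₂ b o F y)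
    (v : V) :
    Conn ends (flipOn F (starFlip ends (oArm ends a₂ o F y) y)) a₂ v ↔
      Conn ends (flipOn F y) a₂ v ∨ v ∈ oArm ends a₂ o F y := by
  set Z := oArm ends a₂ o F y with hZdef
  have hZ : Admissible ends a₁ a₂ o F Z y := admissible_oArm ends a₁ a₂ b o F hF hs
  constructor
  · intro hv
    have key : v ∈ {x : V | Conn ends (flipOn F y) a₂ x ∨ x ∈ Z} := by
      refine mem_of_conn_of_closed (ends := ends) (ω := flipOn F (starFlip ends Z y)) ?_
        (Or.inl (conn_refl _ _ _)) hv
      intro x hx z hxz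
      obtain ⟨_, e, he, hends⟩ := openGraph_adj.1 hxz
      simp only [Set.mem_setOf_eq] at hx ⊢
      by_cases hT : Touch ends Z e
      · rw [flipOn_starFlip_of_touch ends F hF hT] at he
        by_cases hzZ : z ∈ Z
        · exact Or.inr hzZ
        · have hxZ : x ∈ Z := (mem_or_mem_of_touch ends hends hT).resolve_right hzZ
          exact Or.inl (blue_of_red_adj_oArm ends a₁ a₂ b o F hF hs hxZ hzZ he hends).2
      · rw [flipOn_starFlip_of_not_touch ends F hF hT] at he
        have hxZ : x ∉ Z := fun h => hT (touch_of_ends ends hends h)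
        rcases hx with hx | hx
        · exact Or.inl (conn_trans hx (conn_of_openAdj ⟨e, he, hends⟩))
        · exact absurd hx hxZ
    simpa only [Set.mem_setOf_eq] using key
  · rintro (hv | hv)
    · exact conn_blue_starFlip_a2_of_conn ends a₁ a₂ o F hF hZ hv
    · obtain ⟨c, hc, hroute⟩ := route_of_mem_oArm ends a₁ a₂ b o F hF hs hv
      have h₁ : Conn ends (flipOn F (starFlip ends Z y)) a₂ c :=
        conn_blue_starFlip_a2_of_conn ends a₁ a₂ o F hF hZ hc
      have h₂ : Conn ends (flipOn F (starFlip ends Z y)) v c :=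
        conn_mono (routeCfg_le_flipOn_starFlip ends F hF Z c y) hroute
      exact conn_trans h₁ (conn_symm h₂)

/-- The core is unchanged by the flip. -/
lemma core_starFlip_iff (hF : ∀ e, e ∈ F) {y : Config E} (hs : IsSrc ends a₁ a₂ b o F y)
    (hnd : NoDep ends a₂ o F y) (v : V) :
    (Conn ends (starFlip ends (oArm ends a₂ o F y) y) a₂ v ∧
      Conn ends (flipOn F (starFlip ends (oArm ends a₂ o F y) y)) a₂ v) ↔
      (Conn ends y a₂ v ∧ Conn ends (flipOn F y) a₂ v) := by
  rw [conn_starFlip_iff ends a₁ a₂ b o F hF hs hnd v, conn_blue_starFlip_iff ends a₁ a₂ b o F hF hs v]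
  constructor
  · rintro ⟨⟨hr, hZ⟩, hb | hZ'⟩
    · exact ⟨hr, hb⟩
    · exact absurd hZ' hZ
  · rintro ⟨hr, hb⟩
    have hZ : v ∉ oArm ends a₂ o F y := fun h =>
      (red_of_mem_oArm ends a₁ a₂ b o F hF hs h).2 hb
    exact ⟨⟨hr, hZ⟩, Or.inl hb⟩

/-- The arms are unchanged by the flip. -/
lemma arms_starFlip_iff (hF : ∀ e, e ∈ F) {y : Config E} (hs : IsSrc ends a₁ a₂ b o F y)
    (hnd : NoDep ends a₂ o F y) (v : V) :
    Arms ends a₂ F (starFlip ends (oArm ends a₂ o F y) y) v ↔ Arms ends a₂ F y v := by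
  unfold Arms
  rw [conn_starFlip_iff ends a₁ a₂ b o F hF hs hnd v, conn_blue_starFlip_iff ends a₁ a₂ b o F hF hs v]
  by_cases hZ : v ∈ oArm ends a₂ o F y
  · have hv := red_of_mem_oArm ends a₁ a₂ b o F hF hs hZ
    constructor
    · intro _; exact Or.inl hv
    · intro _; exact Or.inr ⟨fun h => h.2 hZ, Or.inr hZ⟩
  · constructor
    · rintro (⟨⟨hr, _⟩, hb⟩ | ⟨hr, hb | hb⟩)
      · exact Or.inl ⟨hr, fun h => hb (Or.inl h)⟩
      · exact Or.inr ⟨fun h => hr ⟨h, hZ⟩, hb⟩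
      · exact absurd hb hZ
    · rintro (⟨hr, hb⟩ | ⟨hr, hb⟩)
      · exact Or.inl ⟨⟨hr, hZ⟩, fun h => h.elim hb hZ⟩
      · exact Or.inr ⟨fun h => hr h.1, Or.inl hb⟩

/-- `armsCfg` is unchanged by the flip. -/
lemma armsCfg_starFlip (hF : ∀ e, e ∈ F) {y : Config E} (hs : IsSrc ends a₁ a₂ b o F y)
    (hnd : NoDep ends a₂ o F y) :
    armsCfg ends a₂ F (starFlip ends (oArm ends a₂ o F y) y) = armsCfg ends a₂ F y := by
  classical
  funext e
  unfold armsCfg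
  rw [decide_eq_decide]
  exact forall_congr' fun x => forall_congr' fun _ => arms_starFlip_iff ends a₁ a₂ b o F hF hs hnd x

/-- **`Z` is unchanged by the flip.** -/
lemma oArm_starFlip (hF : ∀ e, e ∈ F) {y : Config E} (hs : IsSrc ends a₁ a₂ b o F y)
    (hnd : NoDep ends a₂ o F y) :
    oArm ends a₂ o F (starFlip ends (oArm ends a₂ o F y) y) = oArm ends a₂ o F y := by
  ext v
  rw [mem_oArm_iff, mem_oArm_iff, armsCfg_starFlip ends a₁ a₂ b o F hF hs hnd]

/-- **`NoDep` is preserved by the flip.** -/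
lemma noDep_starFlip (hF : ∀ e, e ∈ F) {y : Config E} (hs : IsSrc ends a₁ a₂ b o F y)
    (hnd : NoDep ends a₂ o F y) : NoDep ends a₂ o F (starFlip ends (oArm ends a₂ o F y) y) := by
  intro v hr hb
  have hcore := (core_starFlip_iff ends a₁ a₂ b o F hF hs hnd v).1 ⟨hr, hb⟩
  rw [oArm_starFlip ends a₁ a₂ b o F hF hs hnd, offZ_starFlip]
  exact hnd v hcore.1 hcore.2

end Flip

section Count

variable {V : Type} {E : Type} [Fintype E] [DecidableEq E] [Fintype V]
variable (ends : E → Sym2 V) (a₁ a₂ b o : V)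

open Classical in
/-- The NoDep sources at the all-free profile. -/
noncomputable def ndSrc : Finset (Config E) :=
  (srcSet ends a₁ a₂ b o Finset.univ (fun _ => false)).filter fun y =>
    NoDep ends a₂ o Finset.univ y

open Classical in
/-- The NoDep targets at the all-free profile. -/
noncomputable def ndTgt : Finset (Config E) :=
  (tgtSet ends a₁ a₂ b o Finset.univ (fun _ => false)).filter fun y =>
    NoDep ends a₂ o Finset.univ y

/-- **THE NoDep THEOREM**: the star flip of `o`'s component of the arms injects the NoDep sources
of row 2′TB into its NoDep targets (all-free profile, every finite multigraph, the mark `b` carried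
along) — the NoDep slice of the row is an involution. -/
theorem card_ndSrc_le_card_ndTgt :
    (ndSrc ends a₁ a₂ b o).card ≤ (ndTgt ends a₁ a₂ b o).card := by
  classical
  have hF : ∀ e, e ∈ (Finset.univ : Finset E) := fun e => Finset.mem_univ e
  have hsrc : ∀ y ∈ ndSrc ends a₁ a₂ b o,
      IsSrc ends a₁ a₂ b o Finset.univ y ∧ NoDep ends a₂ o Finset.univ y := by
    intro y hy
    unfold ndSrc at hy
    rw [Finset.mem_filter] at hy
    unfold srcSet at hy
    rw [Finset.mem_filter] at hy
    exact ⟨hy.1.2.2, hy.2⟩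
  refine Finset.card_le_card_of_injOn
    (fun y => starFlip ends (oArm ends a₂ o Finset.univ y) y) ?_ ?_
  · intro y hy
    rw [Finset.mem_coe] at hy
    obtain ⟨hs, hnd⟩ := hsrc y hy
    rw [Finset.mem_coe]
    show starFlip ends (oArm ends a₂ o Finset.univ y) y ∈ ndTgt ends a₁ a₂ b o
    unfold ndTgt
    rw [Finset.mem_filter]
    refine ⟨?_, noDep_starFlip ends a₁ a₂ b o Finset.univ hF hs hnd⟩
    unfold tgtSet
    rw [Finset.mem_filter]
    exact ⟨Finset.mem_univ _, fun e he => absurd (hF e) he,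
      isTgt_starFlip_oArm ends a₁ a₂ b o Finset.univ hF hs⟩
  · intro y₁ hy₁ y₂ hy₂ heq
    rw [Finset.mem_coe] at hy₁ hy₂
    obtain ⟨hs₁, hnd₁⟩ := hsrc y₁ hy₁
    obtain ⟨hs₂, hnd₂⟩ := hsrc y₂ hy₂
    simp only at heq
    have h₁ := oArm_starFlip ends a₁ a₂ b o Finset.univ hF hs₁ hnd₁
    have h₂ := oArm_starFlip ends a₁ a₂ b o Finset.univ hF hs₂ hnd₂
    have hZ : oArm ends a₂ o Finset.univ y₁ = oArm ends a₂ o Finset.univ y₂ := by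
      rw [← h₁, ← h₂, heq]
    calc y₁ = starFlip ends (oArm ends a₂ o Finset.univ y₁)
            (starFlip ends (oArm ends a₂ o Finset.univ y₁) y₁) :=
          (starFlip_starFlip ends _ y₁).symm
      _ = starFlip ends (oArm ends a₂ o Finset.univ y₂)
            (starFlip ends (oArm ends a₂ o Finset.univ y₂) y₂) := by rw [heq, hZ]
      _ = y₂ := starFlip_starFlip ends _ y₂

end Count

end TB14NoDepInv

end Summit.Ventures.PercRepro2
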